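import Mathlib
import Summits.ABC.ABC.Theses.TwistAmplification

/-!
# Crux `TwistAmplification.SharpModerateLaw` (stmt-ABC-1975), stub `stub_cuspStationaryPhase`

Line `deep-moduli-cusp-dispersion`, registered stub `stub_cuspStationaryPhase` (statement `CuspSumBound` of the
skeleton `Cruxes/SharpModerateLaw/Lines/deep_moduli_cusp_dispersion.lean`, verbatim): the stationary-phase bound
`|S(h₁,h₂;pⁿ)| ≤ 2·p^{n/2}` for the complete cusp sums `S(h₁,h₂;pⁿ) = Σ_{t ∈ (ℤ/pⁿ)ˣ} e((h₁t² + h₂t³)/pⁿ)`,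
`p ≥ 5` prime, `n ≥ 2`, `(h₁,h₂)` not both divisible by `p` (Iwaniec–Kowalski 2004, §12.3, "stationary phase
for prime powers"; no Weil bound is involved since the modulus is powerful). PROVED here, elementarily.

Throughout, `e(x/N) = exp(2πi x/N)` of an integer `x` is Mathlib's `ZMod.stdAddChar (N := N) (x : ZMod N)`
(`ZMod.stdAddChar_coe`), so periodicity is automatic. Contents:
* §A generic inputs: sums over `Finset.range N` vs `ZMod N`, orthogonality `Σ_{z<N} e(zX/N) = N·[N ∣ X]`,
  rescaling `e(dx/(dN)) = e(x/N)`, the reindexing `t = y + Az` of `range (A·B)`, `gcd(y + pᵃz, p) = gcd(y,p)`,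
  and the quadratic Gauss sum with a linear term, `|Σ_{w mod p} e((cw² + lw)/p)| = √p` (`p` odd, `p ∤ c`), by the
  direct orthogonality computation of `G·conj G` (substitute `x = h + y`; the `y`-coefficient is `2ch`);
* §B the critical congruence `2h₁ + 3h₂y ≡ 0 (pᵇ)`: at most one unit class (`card_filter_critical_le_one`);
* §C the first stationary-phase step `t = y + pᵃz` (`n = a + b`, `1 ≤ b ≤ a`): `S = pᵇ·Σ_{critical units y<pᵃ} e(f(y)/pⁿ)`;
* §D the odd case `n = 2b+1`: along the critical class `y = u + pᵇw` the `w`-sum is a unimodular factor times a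
  quadratic Gauss sum mod `p` (leading coefficient `h₁ + 3h₂u`, a unit), of modulus `√p`;
* §E the registered stub.
-/

noncomputable section

-- `Summit.<Summit>.<Problem>` is the mandated summit-side namespace (CONVENTIONS §2); for the
-- single-conjunct summit `ABC` the two coincide, so the duplicate `ABC.ABC` is deliberate.
set_option linter.dupNamespace false

namespace Summit.ABC.ABC.Theorems.SharpModerateLaw.DeepModuli

open Finset

/-! ## A. Generic inputs: additive characters to modulus `N` -/

/-- A sum over `Finset.range N` of a function of the residue class is the sum over `ZMod N`. [folklore] -/
theorem sum_range_eq_sum_zmod {M : Type*} [AddCommMonoid M] (N : ℕ) [NeZero N] (g : ZMod N → M) :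
    ∑ w ∈ Finset.range N, g (w : ZMod N) = ∑ x : ZMod N, g x := by
  refine Finset.sum_nbij' (fun w : ℕ => (w : ZMod N)) (fun x : ZMod N => x.val) (fun _ _ => Finset.mem_univ _)
    (fun x _ => Finset.mem_range.mpr (ZMod.val_lt x)) (fun w hw => ?_) (fun x _ => ?_) (fun _ _ => rfl)
  · simp only [ZMod.val_natCast, Nat.mod_eq_of_lt (Finset.mem_range.mp hw)]
  · simp only [ZMod.natCast_zmod_val]

/-- Orthogonality of additive characters to modulus `N`: `Σ_{z<N} e(zX/N)` is `N` if `N ∣ X` and `0`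
otherwise. [folklore] -/
theorem sum_range_stdAddChar_mul (N : ℕ) [NeZero N] (X : ℤ) :
    ∑ z ∈ Finset.range N, ZMod.stdAddChar (N := N) ((z * X : ℤ) : ZMod N) =
      if (N : ℤ) ∣ X then (N : ℂ) else 0 := by
  classical
  have h1 : ∀ z : ℕ, ((z * X : ℤ) : ZMod N) = (z : ZMod N) * (X : ZMod N) := fun z => by push_cast; ring
  simp_rw [h1]
  rw [sum_range_eq_sum_zmod N (fun x => ZMod.stdAddChar (x * (X : ZMod N))),
    AddChar.sum_mulShift _ (ZMod.isPrimitive_stdAddChar N), ZMod.card]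
  by_cases hX : (N : ℤ) ∣ X
  · rw [if_pos hX, if_pos ((ZMod.intCast_zmod_eq_zero_iff_dvd X N).mpr hX)]
  · rw [if_neg hX, if_neg (mt (ZMod.intCast_zmod_eq_zero_iff_dvd X N).mp hX), Nat.cast_zero]

/-- Rescaling: `e(d·x/(d·N)) = e(x/N)`. [folklore] -/
theorem stdAddChar_mul_eq {M N d : ℕ} [NeZero M] [NeZero N] (h : M = d * N) (x : ℤ) :
    ZMod.stdAddChar (N := M) ((d * x : ℤ) : ZMod M) = ZMod.stdAddChar (N := N) (x : ZMod N) := by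
  rw [ZMod.stdAddChar_coe, ZMod.stdAddChar_coe, h]
  congr 1
  have hd : d ≠ 0 := by
    rintro rfl
    rw [zero_mul] at h
    exact NeZero.ne M h
  have hd' : (d : ℂ) ≠ 0 := by exact_mod_cast hd
  have hN : (N : ℂ) ≠ 0 := by exact_mod_cast NeZero.ne N
  push_cast
  field_simp

/-- Reindexing a sum over `Finset.range (A * B)` by `t = y + A z`, `y < A`, `z < B`. [folklore] -/
theorem sum_range_mul_eq_sum_sum {M : Type*} [AddCommMonoid M] (F : ℕ → M) (A B : ℕ) :
    ∑ t ∈ Finset.range (A * B), F t = ∑ y ∈ Finset.range A, ∑ z ∈ Finset.range B, F (y + A * z) := by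
  induction B with
  | zero => simp
  | succ B ih =>
    rw [Nat.mul_succ, Finset.sum_range_add, ih, ← Finset.sum_add_distrib]
    refine Finset.sum_congr rfl (fun y _ => ?_)
    rw [Finset.sum_range_succ, add_comm (A * B) y]

/-- `y + pᵃ z` is prime to `p` iff `y` is, for `a ≠ 0`. [folklore] -/
theorem coprime_add_pow_mul_iff {p a : ℕ} (ha : a ≠ 0) (y z : ℕ) :
    Nat.Coprime (y + p ^ a * z) p ↔ Nat.Coprime y p := by
  obtain ⟨a', rfl⟩ := Nat.exists_eq_succ_of_ne_zero ha
  rw [pow_succ, mul_comm (p ^ a') p, mul_assoc]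
  exact Nat.coprime_add_mul_left_left y p (p ^ a' * z)

/-- `G · conj G = p` for `G = Σ_{x mod p} e((cx² + lx)/p)`, `p` an odd prime, `c ≢ 0`: expand the product,
substitute `x = h + y` and use orthogonality in `y` (the coefficient of `y` is `2ch`, which vanishes
only for `h = 0`). [folklore] -/
theorem gaussSum_mul_conj {p : ℕ} [Fact p.Prime] (hp2 : p ≠ 2) {c : ZMod p} (hc : c ≠ 0) (l : ZMod p) :
    (∑ x : ZMod p, ZMod.stdAddChar (c * x ^ 2 + l * x)) *
      starRingEnd ℂ (∑ x : ZMod p, ZMod.stdAddChar (c * x ^ 2 + l * x)) = (p : ℂ) := by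
  classical
  set ψ := ZMod.stdAddChar (N := p) with hψ
  have hprim : ψ.IsPrimitive := ZMod.isPrimitive_stdAddChar p
  have hchar : 0 < ringChar (ZMod p) := by
    rw [ZMod.ringChar_zmod_n]; exact (Fact.out : p.Prime).pos
  have h2 : (2 : ZMod p) ≠ 0 := Ring.two_ne_zero (by rw [ZMod.ringChar_zmod_n]; exact hp2)
  rw [map_sum]
  simp_rw [AddChar.starComp_apply hchar, AddChar.inv_apply]
  rw [Finset.sum_mul_sum, Finset.sum_comm]
  have e1 : ∀ y : ZMod p, ∑ x : ZMod p, ψ (c * x ^ 2 + l * x) * ψ (-(c * y ^ 2 + l * y))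
      = ∑ h : ZMod p, ψ (c * h ^ 2 + l * h) * ψ (y * (2 * c * h)) := by
    intro y
    rw [← Equiv.sum_comp (Equiv.addRight y)]
    refine Fintype.sum_congr _ _ (fun h => ?_)
    rw [← AddChar.map_add_eq_mul, ← AddChar.map_add_eq_mul, Equiv.coe_addRight]
    congr 1
    ring
  simp_rw [e1]
  rw [Finset.sum_comm]
  simp_rw [← Finset.mul_sum, AddChar.sum_mulShift _ hprim, ZMod.card]
  rw [Finset.sum_eq_single (0 : ZMod p)]
  · simp
  · intro h _ hh
    rw [if_neg (mul_ne_zero (mul_ne_zero h2 hc) hh), Nat.cast_zero, mul_zero]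
  · intro h
    exact absurd (Finset.mem_univ _) h

/-- **The quadratic Gauss sum has modulus `√p`.** For an odd prime `p`, `p ∤ c` and any `l`,
`|Σ_{w<p} e((cw² + lw)/p)| = √p`. [folklore] -/
theorem norm_sum_range_quadratic {p : ℕ} [Fact p.Prime] (hp2 : p ≠ 2) {c : ℤ} (hc : ¬ (p : ℤ) ∣ c)
    (l : ℤ) :
    ‖∑ w ∈ Finset.range p, ZMod.stdAddChar (N := p) ((c * w ^ 2 + l * w : ℤ) : ZMod p)‖ = Real.sqrt p := by
  have h1 : ∀ w : ℕ, ((c * w ^ 2 + l * w : ℤ) : ZMod p) =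
      (c : ZMod p) * (w : ZMod p) ^ 2 + (l : ZMod p) * (w : ZMod p) := by
    intro w; push_cast; ring
  simp_rw [h1]
  rw [sum_range_eq_sum_zmod p (fun x => ZMod.stdAddChar ((c : ZMod p) * x ^ 2 + (l : ZMod p) * x))]
  set G := ∑ x : ZMod p, ZMod.stdAddChar ((c : ZMod p) * x ^ 2 + (l : ZMod p) * x) with hG
  have hc' : (c : ZMod p) ≠ 0 := by
    rw [Ne, ZMod.intCast_zmod_eq_zero_iff_dvd]; exact hc
  have hGG : G * starRingEnd ℂ G = (p : ℂ) := gaussSum_mul_conj hp2 hc' _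
  have hnorm : ‖G‖ ^ 2 = p := by
    rw [Complex.mul_conj'] at hGG
    exact_mod_cast hGG
  rw [← Real.sqrt_sq (norm_nonneg G), hnorm]

/-! ## B. The critical congruence `2h₁ + 3h₂y ≡ 0 (mod pᵇ)` -/

/-- If `p ≥ 5` is prime, `(h₁, h₂)` are not both divisible by `p`, and `pᵇ ∣ 2h₁ + 3h₂u` for some
`b ≥ 1`, then `p ∤ h₂` (otherwise `p ∣ 2h₁`, so `p ∣ h₁` as `p` is odd). -/
theorem not_dvd_of_dvd_linear {p : ℕ} (hp : p.Prime) (h5 : 5 ≤ p) {h₁ h₂ : ℤ}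
    (hnot : ¬ ((p : ℤ) ∣ h₁ ∧ (p : ℤ) ∣ h₂)) {b : ℕ} (hb : b ≠ 0) {u : ℤ}
    (hdiv : (p : ℤ) ^ b ∣ 2 * h₁ + 3 * h₂ * u) : ¬ (p : ℤ) ∣ h₂ := by
  intro h2
  have hpZ : Prime (p : ℤ) := Nat.prime_iff_prime_int.mp hp
  have hpb : (p : ℤ) ∣ 2 * h₁ + 3 * h₂ * u := (dvd_pow_self (p : ℤ) hb).trans hdiv
  have h2h1 : (p : ℤ) ∣ 2 * h₁ := by
    rw [show 2 * h₁ = (2 * h₁ + 3 * h₂ * u) - 3 * u * h₂ by ring]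
    exact dvd_sub hpb (dvd_mul_of_dvd_right h2 _)
  rcases hpZ.dvd_or_dvd h2h1 with h | h
  · have := Int.le_of_dvd (by norm_num) h
    omega
  · exact hnot ⟨h, h2⟩

/-- **At most one critical class.** For `p ≥ 5` prime, `(h₁,h₂)` not both divisible by `p` and `b ≥ 1`,
at most one `y ∈ [0, pᵇ)` prime to `p` satisfies `pᵇ ∣ 2h₁ + 3h₂y` (two solutions differ by a multiple
of `pᵇ`, since `3h₂` is then a unit modulo `p`). -/
theorem card_filter_critical_le_one {p : ℕ} (hp : p.Prime) (h5 : 5 ≤ p) {h₁ h₂ : ℤ}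
    (hnot : ¬ ((p : ℤ) ∣ h₁ ∧ (p : ℤ) ∣ h₂)) {b : ℕ} (hb : b ≠ 0) :
    ((Finset.range (p ^ b)).filter
      (fun y : ℕ => Nat.Coprime y p ∧ (p : ℤ) ^ b ∣ 2 * h₁ + 3 * h₂ * y)).card ≤ 1 := by
  rw [Finset.card_le_one]
  intro y hy y' hy'
  rw [Finset.mem_filter, Finset.mem_range] at hy hy'
  obtain ⟨hylt, -, hyd⟩ := hy
  obtain ⟨hy'lt, -, hy'd⟩ := hy'
  have hpZ : Prime (p : ℤ) := Nat.prime_iff_prime_int.mp hp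
  have hh₂ : ¬ (p : ℤ) ∣ h₂ := not_dvd_of_dvd_linear hp h5 hnot hb hyd
  have h3 : ¬ (p : ℤ) ∣ 3 * h₂ := by
    intro h
    rcases hpZ.dvd_or_dvd h with h | h
    · have := Int.le_of_dvd (by norm_num) h
      omega
    · exact hh₂ h
  have hcop : IsCoprime ((p : ℤ) ^ b) (3 * h₂) :=
    IsCoprime.pow_left ((Prime.coprime_iff_not_dvd hpZ).mpr h3)
  have hdiff : (p : ℤ) ^ b ∣ (3 * h₂) * ((y : ℤ) - y') := by
    rw [show (3 * h₂) * ((y : ℤ) - y') = (2 * h₁ + 3 * h₂ * y) - (2 * h₁ + 3 * h₂ * y') by ring]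
    exact dvd_sub hyd hy'd
  have hy1 : (y : ℤ) < (p : ℤ) ^ b := by exact_mod_cast hylt
  have hy2 : (y' : ℤ) < (p : ℤ) ^ b := by exact_mod_cast hy'lt
  have hy0 : (0 : ℤ) ≤ y := Nat.cast_nonneg y
  have hy0' : (0 : ℤ) ≤ y' := Nat.cast_nonneg y'
  have h0 := Int.eq_zero_of_abs_lt_dvd (hcop.dvd_of_dvd_mul_left hdiff)
    (abs_sub_lt_iff.mpr ⟨by linarith, by linarith⟩)
  omega

/-! ## C. The first stationary-phase step: `t = y + pᵃz`, `n = a + b`, `1 ≤ b ≤ a` -/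

/-- **First step.** For `n = a + b` with `1 ≤ b ≤ a`, substituting `t = y + pᵃz` (`y < pᵃ`, `z < pᵇ`) and using
`f(y + pᵃz) ≡ f(y) + pᵃ z f′(y) (mod pⁿ)` (`2a ≥ n`) together with orthogonality in `z`:
`S(h₁,h₂;pⁿ) = pᵇ · Σ_{y < pᵃ, p ∤ y, pᵇ ∣ 2h₁ + 3h₂y} e(f(y)/pⁿ)` (for a unit `y`,
`pᵇ ∣ f′(y) = y(2h₁ + 3h₂y)` iff `pᵇ ∣ 2h₁ + 3h₂y`). (Iwaniec–Kowalski 2004, §12.3.) -/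
theorem cuspSum_firstStep {p : ℕ} [Fact p.Prime] (h₁ h₂ : ℤ) {a b : ℕ} (hba : b ≤ a) (hb : b ≠ 0) :
    ∑ t ∈ (Finset.range (p ^ (a + b))).filter (fun t : ℕ => Nat.Coprime t p),
        ZMod.stdAddChar (N := p ^ (a + b)) ((h₁ * t ^ 2 + h₂ * t ^ 3 : ℤ) : ZMod (p ^ (a + b)))
      = (p : ℂ) ^ b * ∑ y ∈ (Finset.range (p ^ a)).filter
          (fun y : ℕ => Nat.Coprime y p ∧ (p : ℤ) ^ b ∣ 2 * h₁ + 3 * h₂ * y),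
            ZMod.stdAddChar (N := p ^ (a + b)) ((h₁ * y ^ 2 + h₂ * y ^ 3 : ℤ) : ZMod (p ^ (a + b))) := by
  classical
  have ha : a ≠ 0 := by omega
  -- pointwise splitting of the summand after the substitution `t = y + pᵃ z`
  have hsplit : ∀ y z : ℕ,
      ZMod.stdAddChar (N := p ^ (a + b))
          ((h₁ * ((y + p ^ a * z : ℕ) : ℤ) ^ 2 + h₂ * ((y + p ^ a * z : ℕ) : ℤ) ^ 3 : ℤ) : ZMod (p ^ (a + b)))
        = ZMod.stdAddChar (N := p ^ (a + b)) ((h₁ * y ^ 2 + h₂ * y ^ 3 : ℤ) : ZMod (p ^ (a + b))) *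
          ZMod.stdAddChar (N := p ^ b) ((z * (y * (2 * h₁ + 3 * h₂ * y)) : ℤ) : ZMod (p ^ b)) := by
    intro y z
    obtain ⟨d, rfl⟩ := Nat.exists_eq_add_of_le hba
    have hsc : ZMod.stdAddChar (N := p ^ (b + d + b))
        (((p ^ (b + d) : ℕ) * (z * (y * (2 * h₁ + 3 * h₂ * y))) : ℤ) : ZMod (p ^ (b + d + b)))
        = ZMod.stdAddChar (N := p ^ b) ((z * (y * (2 * h₁ + 3 * h₂ * y)) : ℤ) : ZMod (p ^ b)) :=
      stdAddChar_mul_eq (by ring) _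
    rw [← hsc, ← AddChar.map_add_eq_mul, ← Int.cast_add]
    congr 1
    rw [ZMod.intCast_eq_intCast_iff_dvd_sub]
    refine ⟨-(p ^ d * z ^ 2 * (h₁ + 3 * h₂ * y) + p ^ (b + d + d) * z ^ 3 * h₂), ?_⟩
    push_cast
    ring
  simp only [Finset.sum_filter]
  rw [Finset.mul_sum, show Finset.range (p ^ (a + b)) = Finset.range (p ^ a * p ^ b) by rw [pow_add],
    sum_range_mul_eq_sum_sum _ (p ^ a) (p ^ b)]
  refine Finset.sum_congr rfl (fun y _ => ?_)
  simp only [coprime_add_pow_mul_iff ha, hsplit]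
  by_cases hy : Nat.Coprime y p
  · simp only [if_pos hy]
    rw [← Finset.mul_sum, sum_range_stdAddChar_mul (p ^ b) (y * (2 * h₁ + 3 * h₂ * y))]
    have hcop : IsCoprime ((p : ℤ) ^ b) (y : ℤ) := by
      have h1 : Nat.Coprime (p ^ b) y := Nat.Coprime.pow_left b (Nat.coprime_comm.mp hy)
      exact_mod_cast Nat.isCoprime_iff_coprime.mpr h1
    have hdvd : ((p ^ b : ℕ) : ℤ) ∣ y * (2 * h₁ + 3 * h₂ * y) ↔ (p : ℤ) ^ b ∣ 2 * h₁ + 3 * h₂ * y := by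
      push_cast
      exact ⟨fun h => hcop.dvd_of_dvd_mul_left h, fun h => h.mul_left _⟩
    by_cases hL : (p : ℤ) ^ b ∣ 2 * h₁ + 3 * h₂ * y
    · rw [if_pos (hdvd.mpr hL), if_pos ⟨hy, hL⟩, Nat.cast_pow, mul_comm]
    · rw [if_neg (mt hdvd.mp hL), if_neg (fun h => hL h.2), mul_zero, mul_zero]
  · simp only [hy, false_and, if_false, Finset.sum_const_zero, mul_zero]

/-! ## D. The odd case: the quadratic Gauss sum along the critical class -/

/-- **Second step (odd exponent `n = 2b + 1`).** Along the critical class `y = u + pᵇw`, `w < p`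
(`u` a unit with `pᵇ ∣ 2h₁ + 3h₂u = pᵇκ`), `f(u + pᵇw) ≡ f(u) + p²ᵇ(c w² + uκ w) (mod p²ᵇ⁺¹)` with
`c = h₁ + 3h₂u` prime to `p` (`2c ≡ 3h₂u`), so the `w`-sum is `e(f(u)/pⁿ)` times a quadratic Gauss sum
modulo `p`, of modulus exactly `√p`. (Iwaniec–Kowalski 2004, §12.3.) -/
theorem norm_sum_critical_class {p : ℕ} [hpf : Fact p.Prime] (h5 : 5 ≤ p) (h₁ h₂ : ℤ)
    (hnot : ¬ ((p : ℤ) ∣ h₁ ∧ (p : ℤ) ∣ h₂)) {b : ℕ} (hb : b ≠ 0) {u : ℕ} (hu : Nat.Coprime u p)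
    (hdiv : (p : ℤ) ^ b ∣ 2 * h₁ + 3 * h₂ * u) :
    ‖∑ w ∈ Finset.range p, ZMod.stdAddChar (N := p ^ (b + 1 + b))
        ((h₁ * ((u + p ^ b * w : ℕ) : ℤ) ^ 2 + h₂ * ((u + p ^ b * w : ℕ) : ℤ) ^ 3 : ℤ) :
          ZMod (p ^ (b + 1 + b)))‖ = Real.sqrt p := by
  have hp := hpf.out
  obtain ⟨κ, hκ⟩ := hdiv
  have hp2 : p ≠ 2 := by omega
  have hpZ : Prime (p : ℤ) := Nat.prime_iff_prime_int.mp hp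
  -- `c = h₁ + 3h₂u` is prime to `p`
  have hc : ¬ (p : ℤ) ∣ h₁ + 3 * h₂ * u := by
    intro hc
    have hh₂ : ¬ (p : ℤ) ∣ h₂ := not_dvd_of_dvd_linear hp h5 hnot hb ⟨κ, hκ⟩
    have hpu : ¬ (p : ℤ) ∣ (u : ℤ) := fun h =>
      (Nat.Prime.coprime_iff_not_dvd hp).mp (Nat.coprime_comm.mp hu) (Int.natCast_dvd_natCast.mp h)
    have hpb : (p : ℤ) ∣ 2 * h₁ + 3 * h₂ * u := (dvd_pow_self (p : ℤ) hb).trans ⟨κ, hκ⟩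
    have h3 : (p : ℤ) ∣ 3 * (h₂ * u) := by
      rw [show 3 * (h₂ * u) = 2 * (h₁ + 3 * h₂ * u) - (2 * h₁ + 3 * h₂ * u) by ring]
      exact dvd_sub (dvd_mul_of_dvd_right hc _) hpb
    rcases hpZ.dvd_or_dvd h3 with h | h
    · have := Int.le_of_dvd (by norm_num) h
      omega
    · rcases hpZ.dvd_or_dvd h with h | h
      · exact hh₂ h
      · exact hpu h
  -- pointwise factorisation along the class
  have hfac : ∀ w : ℕ, ZMod.stdAddChar (N := p ^ (b + 1 + b))
      ((h₁ * ((u + p ^ b * w : ℕ) : ℤ) ^ 2 + h₂ * ((u + p ^ b * w : ℕ) : ℤ) ^ 3 : ℤ) : ZMod (p ^ (b + 1 + b)))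
      = ZMod.stdAddChar (N := p ^ (b + 1 + b)) ((h₁ * u ^ 2 + h₂ * u ^ 3 : ℤ) : ZMod (p ^ (b + 1 + b))) *
        ZMod.stdAddChar (N := p) (((h₁ + 3 * h₂ * u) * w ^ 2 + (u * κ) * w : ℤ) : ZMod p) := by
    intro w
    obtain ⟨b', rfl⟩ : ∃ b', b = b' + 1 := ⟨b - 1, by omega⟩
    have hsc : ZMod.stdAddChar (N := p ^ (b' + 1 + 1 + (b' + 1)))
        (((p ^ (b' + 1 + (b' + 1)) : ℕ) * ((h₁ + 3 * h₂ * u) * w ^ 2 + (u * κ) * w) : ℤ) :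
          ZMod (p ^ (b' + 1 + 1 + (b' + 1))))
        = ZMod.stdAddChar (N := p) (((h₁ + 3 * h₂ * u) * w ^ 2 + (u * κ) * w : ℤ) : ZMod p) :=
      stdAddChar_mul_eq (by ring) _
    rw [← hsc, ← AddChar.map_add_eq_mul, ← Int.cast_add]
    congr 1
    rw [ZMod.intCast_eq_intCast_iff_dvd_sub]
    refine ⟨-(p ^ b' * h₂ * w ^ 3), ?_⟩
    push_cast
    linear_combination (-((p : ℤ) ^ (b' + 1) * w * u)) * hκ
  simp_rw [hfac]
  rw [← Finset.mul_sum, norm_mul, AddChar.norm_apply, one_mul]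
  exact norm_sum_range_quadratic hp2 hc (u * κ)

/-! ## E. The registered stub -/

/-- **STUB `stub_cuspStationaryPhase`** of the line `deep-moduli-cusp-dispersion` (crux stmt-ABC-1975,
statement `CuspSumBound` of the skeleton, verbatim): for `p ≥ 5` prime, `n ≥ 2` and `(h₁, h₂)` not both
divisible by `p`, the complete cusp sum satisfies `|S(h₁,h₂;pⁿ)| ≤ 2·p^{n/2}`.
Proof: write `n = a + b` with `b = ⌊n/2⌋ ≥ 1`, `a ∈ {b, b+1}`; by `cuspSum_firstStep`,
`S = pᵇ · Σ_{critical units y < pᵃ} e(f(y)/pⁿ)`. For `n` even (`a = b`) there is at most one critical class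
(`card_filter_critical_le_one`), so `|S| ≤ pᵇ = p^{n/2}`. For `n` odd (`a = b + 1`) reindex `y = u + pᵇw`;
the critical `u < pᵇ` form at most one class and along it the `w`-sum has modulus `√p`
(`norm_sum_critical_class`), so `|S| ≤ pᵇ√p = p^{n/2}`. The factor `2` is slack. (Iwaniec–Kowalski 2004, §12.3.) -/
theorem stub_cuspStationaryPhase :
    ∀ p n : ℕ, p.Prime → 5 ≤ p → 2 ≤ n → ∀ h₁ h₂ : ℤ, ¬ ((p : ℤ) ∣ h₁ ∧ (p : ℤ) ∣ h₂) →
      ‖∑ t ∈ (Finset.range (p ^ n)).filter (fun t : ℕ => Nat.Coprime t p),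
          Complex.exp (2 * (Real.pi : ℂ) * Complex.I * ((h₁ : ℂ) * (t : ℂ) ^ 2 + (h₂ : ℂ) * (t : ℂ) ^ 3) /
            (p : ℂ) ^ n)‖ ≤ 2 * (p : ℝ) ^ ((n : ℝ) / 2) := by
  intro p n hp h5 hn h₁ h₂ hnot
  haveI := Fact.mk hp
  obtain ⟨a, b, rfl, hba, hab, hb⟩ : ∃ a b : ℕ, n = a + b ∧ b ≤ a ∧ a ≤ b + 1 ∧ 1 ≤ b :=
    ⟨n - n / 2, n / 2, by omega, by omega, by omega, by omega⟩
  have hsummand : ∀ t : ℕ, Complex.exp (2 * (Real.pi : ℂ) * Complex.I *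
      ((h₁ : ℂ) * (t : ℂ) ^ 2 + (h₂ : ℂ) * (t : ℂ) ^ 3) / (p : ℂ) ^ (a + b))
      = ZMod.stdAddChar (N := p ^ (a + b)) ((h₁ * t ^ 2 + h₂ * t ^ 3 : ℤ) : ZMod (p ^ (a + b))) := by
    intro t
    rw [ZMod.stdAddChar_coe]
    push_cast
    ring_nf
  rw [Finset.sum_congr rfl (fun t _ => hsummand t), cuspSum_firstStep h₁ h₂ hba (by omega),
    norm_mul, norm_pow, Complex.norm_natCast]
  have hp0 : (0 : ℝ) < p := by exact_mod_cast hp.pos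
  have hcard := card_filter_critical_le_one hp h5 hnot (b := b) (by omega) (h₁ := h₁) (h₂ := h₂)
  have hpow_pos : (0 : ℝ) < (p : ℝ) ^ b := by positivity
  rcases Nat.eq_or_lt_of_le hba with h | h
  · -- even exponent: `a = b`
    subst h
    have hT : ‖∑ y ∈ (Finset.range (p ^ b)).filter
          (fun y : ℕ => Nat.Coprime y p ∧ (p : ℤ) ^ b ∣ 2 * h₁ + 3 * h₂ * y),
            ZMod.stdAddChar (N := p ^ (b + b)) ((h₁ * y ^ 2 + h₂ * y ^ 3 : ℤ) : ZMod (p ^ (b + b)))‖ ≤ 1 := by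
      refine (norm_sum_le _ _).trans ?_
      simp only [AddChar.norm_apply, Finset.sum_const, nsmul_eq_mul, mul_one]
      exact_mod_cast hcard
    have hexp : (p : ℝ) ^ (((b + b : ℕ) : ℝ) / 2) = (p : ℝ) ^ b := by
      rw [show ((b + b : ℕ) : ℝ) / 2 = (b : ℝ) by push_cast; ring, Real.rpow_natCast]
    rw [hexp]
    nlinarith
  · -- odd exponent: `a = b + 1`
    obtain rfl : a = b + 1 := by omega
    have hb0 : b ≠ 0 := by omega
    -- reindex the critical sum along `y = u + pᵇ w`
    have hreindex : ∑ y ∈ (Finset.range (p ^ (b + 1))).filter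
          (fun y : ℕ => Nat.Coprime y p ∧ (p : ℤ) ^ b ∣ 2 * h₁ + 3 * h₂ * y),
            ZMod.stdAddChar (N := p ^ (b + 1 + b)) ((h₁ * y ^ 2 + h₂ * y ^ 3 : ℤ) : ZMod (p ^ (b + 1 + b)))
        = ∑ u ∈ (Finset.range (p ^ b)).filter
          (fun y : ℕ => Nat.Coprime y p ∧ (p : ℤ) ^ b ∣ 2 * h₁ + 3 * h₂ * y),
            ∑ w ∈ Finset.range p, ZMod.stdAddChar (N := p ^ (b + 1 + b))
              ((h₁ * ((u + p ^ b * w : ℕ) : ℤ) ^ 2 + h₂ * ((u + p ^ b * w : ℕ) : ℤ) ^ 3 : ℤ) :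
                ZMod (p ^ (b + 1 + b))) := by
      simp only [Finset.sum_filter]
      rw [show Finset.range (p ^ (b + 1)) = Finset.range (p ^ b * p) by rw [pow_succ],
        sum_range_mul_eq_sum_sum _ (p ^ b) p]
      refine Finset.sum_congr rfl (fun u _ => ?_)
      have hdvd : ∀ w : ℕ, ((p : ℤ) ^ b ∣ 2 * h₁ + 3 * h₂ * ((u + p ^ b * w : ℕ) : ℤ)) ↔
          ((p : ℤ) ^ b ∣ 2 * h₁ + 3 * h₂ * (u : ℤ)) := by
        intro w
        rw [show 2 * h₁ + 3 * h₂ * ((u + p ^ b * w : ℕ) : ℤ) =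
            (2 * h₁ + 3 * h₂ * (u : ℤ)) + (p : ℤ) ^ b * (3 * h₂ * w) by push_cast; ring]
        exact dvd_add_left (dvd_mul_right _ _)
      simp only [coprime_add_pow_mul_iff hb0, hdvd]
      by_cases hPu : Nat.Coprime u p ∧ (p : ℤ) ^ b ∣ 2 * h₁ + 3 * h₂ * (u : ℤ)
      · simp only [if_pos hPu]
      · simp only [if_neg hPu, Finset.sum_const_zero]
    have hT : ‖∑ y ∈ (Finset.range (p ^ (b + 1))).filter
          (fun y : ℕ => Nat.Coprime y p ∧ (p : ℤ) ^ b ∣ 2 * h₁ + 3 * h₂ * y),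
            ZMod.stdAddChar (N := p ^ (b + 1 + b)) ((h₁ * y ^ 2 + h₂ * y ^ 3 : ℤ) : ZMod (p ^ (b + 1 + b)))‖
        ≤ Real.sqrt p := by
      rw [hreindex]
      refine (norm_sum_le _ _).trans ?_
      rw [Finset.sum_congr rfl (fun u hu => by
        obtain ⟨-, hcop, hdiv⟩ := Finset.mem_filter.mp hu
        exact norm_sum_critical_class h5 h₁ h₂ hnot hb0 hcop hdiv), Finset.sum_const, nsmul_eq_mul]
      have hs : (0 : ℝ) ≤ Real.sqrt p := Real.sqrt_nonneg _
      have hc1 : (((Finset.range (p ^ b)).filter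
          (fun y : ℕ => Nat.Coprime y p ∧ (p : ℤ) ^ b ∣ 2 * h₁ + 3 * h₂ * y)).card : ℝ) ≤ 1 := by
        exact_mod_cast hcard
      nlinarith
    have hexp : (p : ℝ) ^ (((b + 1 + b : ℕ) : ℝ) / 2) = (p : ℝ) ^ b * Real.sqrt p := by
      rw [show ((b + 1 + b : ℕ) : ℝ) / 2 = (b : ℝ) + 1 / 2 by push_cast; ring, Real.rpow_add hp0,
        Real.rpow_natCast, Real.sqrt_eq_rpow]
    rw [hexp]
    have hs : (0 : ℝ) ≤ Real.sqrt p := Real.sqrt_nonneg _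
    nlinarith [mul_le_mul_of_nonneg_left hT hpow_pos.le]

end Summit.ABC.ABC.Theorems.SharpModerateLaw.DeepModuli

end
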